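import Literature.Barriers.CriticalPhenomena.RigorousRGSmallParameterLocComponent
import HarnessLib

/-!
# `RigorousRGSmallParameter` (Slade, Theorem 1.4.1): the range of the localisation operator for
# symmetric functionals — `Loc_x F = gτ_x² + ντ_x + u` (Slade §4.2, "symmetry considerations")

Companion ("proof architecture") file of
`Literature/Barriers/CriticalPhenomena/RigorousRGSmallParameter.lean`, the culmination of the `Loc`
files. Slade §4.2 describes the localisation operator of [BS-rg-loc] for his model as "a linear
projection map `Loc_X : 𝒩 → 𝒰(X)`" onto `𝒰(X) = {Σ_{x∈X}(gτ_x² + ντ_x + u)}` with range "spanned by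
`{1, τ, τ²}`", having noted after Definition 3.4.2 that "symmetry considerations preclude the
occurrence of monomials with an odd number of fields or an odd number of gradients". The Loc files
formalize [BS-rg-loc]'s operator with its FULL range `𝒱` (all symmetrised monomials of dimension
`≤ d_+`), as [BBS-rg-pt] §3.2 and [BS-rg-step] specify it; this file PROVES that on symmetric
inputs its value at a single point lies in Slade's `𝒰`:

**`locX_singleton_eq_localPoly`.** Let `F ∈ 𝒩(U)` be smooth, with `U` in the coordinate patch of
`x` containing the reach `⌊d_+⌋` of `x`; suppose `F` is invariant under the reflection of every
axis through `x` and under the pointwise action `φ_y ↦ Rφ_y` of every orthogonal matrix `R` (the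
`O(n)` symmetry), and that the dimensions satisfy `d_+ < 2[φ] + 2` and `d_+ < 5[φ]` (Slade:
`[φ] = ½(d-α)`, `d_+ = d`, `α = ½(d+ε)`: `2[φ] + 2 = d - α + 2 > d` as `α < 2`; `5[φ] > d` as
`α < 3d/5`). Then `Loc_x F = Loc_{{x}} F = gτ_x² + ντ_x + u` for some `g, ν, u ∈ ℝ`
(`τ_x = ½|φ_x|²`).

Proof (following the quoted symmetry remark): (i) for the flip of one component, `Loc` covariance
(`…LocComponent`) gives `β_C = 0` unless that component occurs an even number of times in `C`;
(ii) for the reflection of axis `k`, `Σ_axes`-covariance of `P̂` and Proposition 1.4.4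
(`…LocCovariance`) give `β_C = 0` unless axis `k` carries an even number of derivatives; (iii) hence
a surviving class has even degree and even total order, and the dimension constraint leaves only
classes WITHOUT derivatives of degree `0, 2, 4`; (iv) so `Loc_x F(φ) = P(φ_x)` for a polynomial
`P` on `ℝⁿ`, which is `O(n)`-invariant (covariance again) and hence radial (a Householder
reflection maps `w` to `‖w‖e_0`): `P(w) = A_0 + A_2‖w‖² + A_4‖w‖⁴ = u + ντ_x + gτ_x²`.

Sources: G. Slade, *Critical exponents for long-range O(n) models below the upper critical
dimension*, Commun. Math. Phys. 358 (2018) 343–436, arXiv:1611.06169 — §4.2 (the two quoted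
sentences), Definition 3.4.2 and the sentence following it, §1.2 (`O(n)` invariance); D. C.
Brydges, G. Slade [BS-rg-loc] arXiv:1403.7253 — Propositions 1.4.3–1.4.4, §1.5.

## What this file provides (definitions with proved properties; no named fact)

* `relabelCls_one`, `relabelF_one`, `reflAxis`, **`betaVec_eq_zero_of_reflAxis`**, `flipComp`,
  `prod_flipComp`, **`betaVec_eq_zero_of_flipComp`**.
* `exists_odd_count_of_odd_length`, `length_rep_le`, `tordF_rep_le`, `sgnM_flipM_singleton`,
  `even_tordF_of_all_even`, `length_eq_sum_count_fst`, `forall_nil_of_tordF_eq_zero`,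
  **`phatX_singleton_of_tordF_eq_zero`** (`P̂_m({x}) = ∏_k φ^{i_k}_x` without derivatives),
  `prod_map_smul`.
* `siteField`, `siteField_self`, `compMap_siteField`, `enorm`, `enorm_sq`, `IsOrth`,
  `isOrth_diagR_flipComp`, **`householder`**, `isOrth_householder`, `householder_apply`.
* **`locX_singleton_eq_localPoly`** (Slade's range of `Loc_x`).

## References

* [Slade2017] G. Slade, *Critical exponents for long-range O(n) models below the upper critical
  dimension*, Commun. Math. Phys. 358 (2018) 343–436, arXiv:1611.06169 — §4.2, Definition 3.4.2.
* [BrydgesSlade2015RGII] D. C. Brydges, G. Slade, *A renormalisation group method. II.*,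
  J. Stat. Phys. 159 (2015) 461–491, arXiv:1403.7253 — Propositions 1.4.3–1.4.4, §1.5.
-/

noncomputable section

namespace Literature.Barriers.CriticalPhenomena

namespace LongRangePhi4

namespace Loc

open Finset Tphi RGNorm LocalPoly Polymer Literature.Probability.LatticeModels Matrix
open scoped ContDiff

variable {d M n : ℕ} [NeZero M]

/-! ### Killing of coefficients by the discrete symmetries -/

omit [NeZero M] in
/-- Relabelling by the identity permutation. [folklore] -/
theorem relabelCls_one (C : Multiset (Fin n × Multiset (Fin d))) : relabelCls (Equiv.refl (Fin d)) C = C := by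
  simp only [relabelCls, Equiv.coe_refl, Multiset.map_id]
  conv_rhs => rw [← Multiset.map_id C]
  rfl

omit [NeZero M] in
/-- `relabelF 1 = id`. [folklore] -/
theorem relabelF_one (m' : List (Fin n × List (Fin d))) : AxisSym.relabelF (Equiv.refl (Fin d)) m' = m' := by
  simp [AxisSym.relabelF]

/-- The reflection of the axis `k` through the point `a`: `Θ = (id, {k})`. [cite: BrydgesSlade2015RGII, §1.2 (Σ_axes)] -/
def reflAxis (k : Fin d) : AxisSym d := ⟨Equiv.refl (Fin d), {k}⟩

/-- **Reflection invariance kills classes with an odd number of derivatives along the reflected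
axis**: if `F ∘ T_E = F` for the reflection `E` of axis `k` through `a`, and `E X = X`, then
`β_C = 0` whenever `sgn(Θ_{{k}} rep C) = -1` ("… or an odd number of gradients"). [cite: Slade2017, Definition 3.4.2 (the sentence following it)] [cite: BrydgesSlade2015RGII, Proposition 1.4.4] -/
theorem betaVec_eq_zero_of_reflAxis {pN : ℕ} {dφ dplus : ℝ} (hA : LocAdm M n pN dφ dplus) (k : Fin d) {a : TorusSite d M}
    {X U : Finset (TorusSite d M)} (hXne : X.Nonempty) (hX : InPatch a ⌊dplus⌋₊ X)
    (hEX : X.image ((reflAxis k).pt a) = X)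
    (hU : ∀ y ∈ U, ∀ k', 2 * |coord a y k'| < M) (hK : 2 * ((⌊dplus⌋₊ : ℤ) + 1) < M)
    (hXU : ∀ x ∈ X, reach x ⌊dplus⌋₊ ⊆ U)
    {F : (TorusSite d M → Fin n → ℝ) → ℝ} (hF : ContDiff ℝ ∞ F) (hFU : DependsOn U F)
    (hEF : (fun φ => F ((reflAxis k).fieldMap a φ)) = F) (C : vPlus d n dφ dplus)
    (hodd : sgnM (flipM {k} ((rep C.1).map fwd)) = -1) :
    betaVec pN dφ dplus a X F C = 0 := by
  have h := (reflAxis k).betaVec_relabel_of_invariant hA hXne hX hEX hU hK hXU hF hFU hEF C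
  have hC : relabelV (n := n) (dplus := dplus) hA.pos (reflAxis k).perm C = C := by
    apply Subtype.ext
    show relabelCls (reflAxis k).perm C.1 = C.1
    exact relabelCls_one C.1
  rw [hC] at h
  have hn : (reflAxis k).neg = {k} := rfl
  rw [hn, show (reflAxis k).perm = Equiv.refl (Fin d) from rfl, relabelF_one, hodd] at h
  linarith

/-- The flip of the single component `i`. [folklore] -/
def flipComp (i : Fin n) : Fin n → ℝ := fun j => if j = i then -1 else 1

omit [NeZero M] in
/-- The sign of a class under the flip of component `i` is `(-1)^{#occurrences of i}`. [folklore] -/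
theorem prod_flipComp (i : Fin n) (m' : List (Fin n × List (Fin d))) :
    (m'.map fun c => flipComp i c.1).prod = (-1) ^ (m'.map Prod.fst).count i := by
  induction m' with
  | nil => simp
  | cons c m' ih =>
      rw [List.map_cons, List.prod_cons, ih, List.map_cons, List.count_cons]
      simp only [flipComp, beq_iff_eq]
      by_cases h : c.1 = i
      · rw [if_pos h, if_pos h, pow_succ]; ring
      · rw [if_neg h, if_neg h, add_zero, one_mul]

/-- **Component-flip invariance kills classes in which a component occurs an odd number of times**
("… monomials with an odd number of fields"; for `O(n)`-invariant `F`). [cite: Slade2017, Definition 3.4.2 (the sentence following it)] -/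
theorem betaVec_eq_zero_of_flipComp {pN : ℕ} {dφ dplus : ℝ} (hA : LocAdm M n pN dφ dplus) (i : Fin n)
    {a : TorusSite d M} {X : Finset (TorusSite d M)} (hXne : X.Nonempty) (hX : InPatch a ⌊dplus⌋₊ X)
    {F : (TorusSite d M → Fin n → ℝ) → ℝ} (hF : ContDiff ℝ ∞ F) (hinv : (fun φ => F (compMap (diagR (flipComp i)) φ)) = F)
    (C : vPlus d n dφ dplus) (hodd : Odd (((rep C.1).map Prod.fst).count i)) :
    betaVec pN dφ dplus a X F C = 0 := by
  have h := betaVec_signFlip hA (flipComp i) hXne hX hF hinv C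
  rw [prod_flipComp, hodd.neg_one_pow] at h
  linarith

/-! ### Parity and dimension bookkeeping for the classes -/

omit [NeZero M] in
/-- A list of odd length has an element occurring an odd number of times. [folklore] -/
theorem exists_odd_count_of_odd_length {α : Type*} [DecidableEq α] [Fintype α] (l : List α) (h : Odd l.length) :
    ∃ a, Odd (l.count a) := by
  by_contra hne
  simp only [not_exists, Nat.not_odd_iff_even] at hne
  have hsum : ∑ a, l.count a = l.length := by
    have := Multiset.sum_count_eq_card (s := (Finset.univ : Finset α)) (m := (l : Multiset α)) (fun _ _ => Finset.mem_univ _)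
    simpa [Multiset.coe_count] using this
  have heven : Even (∑ a, l.count a) := Finset.even_sum _ fun a _ => hne a
  rw [hsum] at heven
  exact (Nat.not_even_iff_odd.2 h) heven

omit [NeZero M] in
/-- The degree of a class in `𝔳_+` is at most `d_+/[φ]`: `p·[φ] ≤ [M_m] ≤ d_+`. [folklore] -/
theorem length_rep_le {dφ dplus : ℝ} (hφ : 0 < dφ) {C : Multiset (Fin n × Multiset (Fin d))}
    (hC : C ∈ vPlus d n dφ dplus) : ((rep C).length : ℝ) * dφ ≤ dplus :=
  ((dim_ge dφ (rep C)).1).trans ((mem_vbarPlus hφ).1 (rep_mem_vbarPlus hφ hC))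

omit [NeZero M] in
/-- The total order of a class in `𝔳_+`: `p·[φ] + Σ|α_k| ≤ d_+`. [folklore] -/
theorem tordF_rep_le {dφ dplus : ℝ} (hφ : 0 < dφ) {C : Multiset (Fin n × Multiset (Fin d))}
    (hC : C ∈ vPlus d n dφ dplus) : ((rep C).length : ℝ) * dφ + (tordF (rep C) : ℝ) ≤ dplus := by
  have h := (mem_vbarPlus hφ).1 (rep_mem_vbarPlus hφ hC)
  unfold dim at h; unfold tordF; exact h

omit [NeZero M] in
/-- The number of steps along axis `k` in a forward sequence. [folklore] -/
theorem sgnM_flipM_singleton (k : Fin d) (m' : List (Fin n × List (Fin d))) :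
    sgnM (flipM {k} (m'.map fwd)) = (-1) ^ (m'.map fun c => c.2.count k).sum := by
  rw [AxisSym.sgnM_flipM_fwd]
  induction m' with
  | nil => simp
  | cons c m' ih =>
      rw [List.map_cons, List.prod_cons, ih, List.map_cons, List.sum_cons, pow_add]
      congr 1
      induction c.2 with
      | nil => simp
      | cons j l ihl =>
          rw [List.map_cons, List.prod_cons, ihl, List.count_cons, pow_add]
          simp only [Finset.mem_singleton, beq_iff_eq]
          by_cases h : j = k <;> simp [h]

omit [NeZero M] in
/-- If every axis carries an even number of steps then the total order is even. [folklore] -/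
theorem even_tordF_of_all_even (m' : List (Fin n × List (Fin d))) (h : ∀ k, Even ((m'.map fun c => c.2.count k).sum)) :
    Even (tordF m') := by
  have hsum : ∀ l : List (Fin n × List (Fin d)), tordF l = ∑ k, (l.map fun c => c.2.count k).sum := by
    intro l
    unfold tordF
    induction l with
    | nil => simp
    | cons c l ih =>
        simp only [List.map_cons, List.sum_cons]
        rw [ih, Finset.sum_add_distrib, sum_count_dir]
  rw [hsum]
  exact Finset.even_sum _ fun k _ => h k

omit [NeZero M] in
/-- The degree is the sum of the component counts. [folklore] -/
theorem length_eq_sum_count_fst (m' : List (Fin n × List (Fin d))) : m'.length = ∑ i, (m'.map Prod.fst).count i := by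
  have := Multiset.sum_count_eq_card (s := (Finset.univ : Finset (Fin n))) (m := ((m'.map Prod.fst : List (Fin n)) : Multiset (Fin n)))
    (fun _ _ => Finset.mem_univ _)
  simp only [Multiset.coe_count, Multiset.coe_card, List.length_map] at this
  exact this.symm

omit [NeZero M] in
/-- Vanishing total order means no derivatives at all. [folklore] -/
theorem forall_nil_of_tordF_eq_zero {m' : List (Fin n × List (Fin d))} (h : tordF m' = 0) : ∀ c ∈ m', c.2 = [] := by
  intro c hc
  unfold tordF at h
  have := List.sum_eq_zero_iff.1 h c.2.length (List.mem_map.2 ⟨c, hc, rfl⟩)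
  exact List.length_eq_zero_iff.1 this

/-- **`P̂` of a class without derivatives at a single point is the plain product of components**:
`P̂_m({x})(φ) = ∏_k φ^{i_k}_x`. [folklore] -/
theorem phatX_singleton_of_tordF_eq_zero {m' : List (Fin n × List (Fin d))} (h : tordF m' = 0) (x : TorusSite d M) :
    phatX m' {x} = fun φ => (m'.map fun c => φ x c.1).prod := by
  have hnil := forall_nil_of_tordF_eq_zero h
  funext φ
  simp only [phatX, Finset.sum_singleton, phat]
  have hflip : ∀ S : Finset (Fin d), flipM S (m'.map fwd) = m'.map fwd := by
    intro S
    simp only [flipM, List.map_map]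
    refine List.map_congr_left fun c hc => ?_
    simp [fwd, flipL, hnil c hc]
  have hsgn : ∀ S : Finset (Fin d), sgnM (flipM S (m'.map fwd)) = 1 := by
    intro S
    rw [hflip]
    simp only [sgnM, List.map_map]
    rw [List.prod_eq_one]
    intro r hr
    rw [List.mem_map] at hr
    obtain ⟨c, hc, rfl⟩ := hr
    simp [sgnB, fwd, hnil c hc]
  have hmono : monomial (m'.map fwd) x φ = (m'.map fun c => φ x c.1).prod := by
    simp only [monomial, List.map_map]
    congr 1
    refine List.map_congr_left fun c hc => ?_
    simp [fwd, hnil c hc]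
  have hsgn0 : sgnM (m'.map fwd) = 1 := by simpa [hflip] using hsgn ∅
  simp only [hflip, hsgn0, hmono, one_mul, Finset.sum_const, Finset.card_univ, Fintype.card_finset, Fintype.card_fin,
    nsmul_eq_mul]
  push_cast
  rw [← mul_assoc, inv_mul_cancel₀ (by positivity), one_mul]

omit [NeZero M] in
/-- Homogeneity of the plain products: `∏_k (t w)_{i_k} = t^{p} ∏_k w_{i_k}`. [folklore] -/
theorem prod_map_smul (m' : List (Fin n × List (Fin d))) (t : ℝ) (w : Fin n → ℝ) :
    (m'.map fun c => t * w c.1).prod = t ^ m'.length * (m'.map fun c => w c.1).prod := by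
  induction m' with
  | nil => simp
  | cons c m' ih => rw [List.map_cons, List.prod_cons, ih, List.length_cons, pow_succ, List.map_cons, List.prod_cons]; ring

/-! ### The field supported at a single site, and the Householder reflection -/

/-- The field equal to `w` at `x` and `0` elsewhere. [folklore] -/
def siteField (x : TorusSite d M) (w : Fin n → ℝ) : TorusSite d M → Fin n → ℝ := fun y j => if y = x then w j else 0

omit [NeZero M] in
/-- `(siteField x w)_x = w`. [folklore] -/
@[simp] theorem siteField_self (x : TorusSite d M) (w : Fin n → ℝ) : siteField x w x = w := by
  funext j; simp [siteField]

omit [NeZero M] in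
/-- `T_R (siteField x w) = siteField x (Rw)`. [folklore] -/
theorem compMap_siteField (R : Fin n → Fin n → ℝ) (x : TorusSite d M) (w : Fin n → ℝ) :
    compMap R (siteField x w) = siteField x (fun i => ∑ j, R i j * w j) := by
  funext y i
  simp only [compMap_apply, siteField]
  by_cases h : y = x <;> simp [h]

/-- The Euclidean norm of a component vector. [folklore] -/
def enorm (w : Fin n → ℝ) : ℝ := Real.sqrt (∑ i, w i ^ 2)

omit [NeZero M] in
/-- `‖w‖² = Σ_i w_i²`. [folklore] -/
theorem enorm_sq (w : Fin n → ℝ) : enorm w ^ 2 = ∑ i, w i ^ 2 :=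
  Real.sq_sqrt (Finset.sum_nonneg fun _ _ => sq_nonneg _)

/-- Orthogonality of a matrix: `RᵀR = 1`. [folklore] -/
def IsOrth (R : Fin n → Fin n → ℝ) : Prop := ∀ i j, ∑ k, R k i * R k j = if i = j then 1 else 0

omit [NeZero M] in
/-- Diagonal sign matrices are orthogonal. [folklore] -/
theorem isOrth_diagR_flipComp (i : Fin n) : IsOrth (diagR (flipComp i)) := by
  intro a b
  simp only [diagR, flipComp]
  rw [Finset.sum_eq_single a]
  · by_cases hab : a = b
    · subst hab; by_cases h : a = i <;> simp [h]
    · simp [hab]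
  · intro k _ hk; simp [hk]
  · intro h; exact absurd (Finset.mem_univ _) h

/-- **The Householder reflection taking `w` to `‖w‖e_{i₀}`** (the identity if `w = ‖w‖e_{i₀}`):
`H = 1 - 2uuᵀ/(uᵀu)`, `u = w - ‖w‖e_{i₀}`. [folklore] -/
def householder (i₀ : Fin n) (w : Fin n → ℝ) : Fin n → Fin n → ℝ :=
  let u : Fin n → ℝ := fun k => w k - (if k = i₀ then enorm w else 0)
  if ∑ k, u k ^ 2 = 0 then fun i j => if i = j then 1 else 0
  else fun i j => (if i = j then 1 else 0) - 2 / (∑ k, u k ^ 2) * (u i * u j)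

omit [NeZero M] in
/-- The Householder matrix is orthogonal. [folklore] -/
theorem isOrth_householder (i₀ : Fin n) (w : Fin n → ℝ) : IsOrth (householder i₀ w) := by
  intro i j
  unfold householder
  set u : Fin n → ℝ := fun i => w i - (if i = i₀ then enorm w else 0) with hu
  set c : ℝ := ∑ k, u k ^ 2 with hc
  by_cases h0 : c = 0
  · simp only [h0, if_true]
    rw [Finset.sum_eq_single i]
    · by_cases hij : i = j <;> simp [hij]
    · intro k _ hk; simp [hk]
    · intro h; exact absurd (Finset.mem_univ _) h
  · simp only [h0, if_false]
    have hexp : ∀ k, ((if k = i then (1 : ℝ) else 0) - 2 / c * (u k * u i)) * ((if k = j then 1 else 0) - 2 / c * (u k * u j)) =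
        (if k = i then 1 else 0) * (if k = j then 1 else 0) - 2 / c * (u i * ((if k = j then 1 else 0) * u k))
          - 2 / c * (u j * ((if k = i then 1 else 0) * u k)) + (2 / c) ^ 2 * (u i * u j) * u k ^ 2 := by
      intro k; ring
    simp only [hexp, Finset.sum_add_distrib, Finset.sum_sub_distrib, ← Finset.mul_sum]
    have h1 : ∑ k, (if k = i then (1 : ℝ) else 0) * (if k = j then 1 else 0) = if i = j then 1 else 0 := by
      rw [Finset.sum_eq_single i]
      · by_cases hij : i = j <;> simp [hij]
      · intro k _ hk; simp [hk]
      · intro h; exact absurd (Finset.mem_univ _) h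
    have h2 : ∑ k, (if k = j then (1 : ℝ) else 0) * u k = u j := by
      rw [Finset.sum_eq_single j]
      · simp
      · intro k _ hk; simp [hk]
      · intro h; exact absurd (Finset.mem_univ _) h
    have h3 : ∑ k, (if k = i then (1 : ℝ) else 0) * u k = u i := by
      rw [Finset.sum_eq_single i]
      · simp
      · intro k _ hk; simp [hk]
      · intro h; exact absurd (Finset.mem_univ _) h
    rw [h1, h2, h3, ← hc]
    field_simp
    ring

omit [NeZero M] in
/-- The Householder matrix maps `w` to `‖w‖e_{i₀}`. [folklore] -/
theorem householder_apply (i₀ : Fin n) (w : Fin n → ℝ) (i : Fin n) :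
    ∑ j, householder i₀ w i j * w j = if i = i₀ then enorm w else 0 := by
  unfold householder
  set u : Fin n → ℝ := fun i => w i - (if i = i₀ then enorm w else 0) with hu
  set c : ℝ := ∑ k, u k ^ 2 with hc
  have hw : ∀ j, w j = u j + (if j = i₀ then enorm w else 0) := fun j => by simp [hu]
  by_cases h0 : c = 0
  · simp only [h0, if_true]
    have hu0 : ∀ k, u k = 0 := fun k => by
      have := Finset.sum_eq_zero_iff_of_nonneg (fun k _ => sq_nonneg (u k)) |>.1 h0 k (Finset.mem_univ _)
      exact pow_eq_zero_iff (n := 2) (by norm_num) |>.1 this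
    rw [Finset.sum_eq_single i]
    · simp [hw i, hu0 i]
    · intro k _ hk; simp [Ne.symm hk]
    · intro h; exact absurd (Finset.mem_univ _) h
  · simp only [h0, if_false]
    -- `Hw = w - (2 u·w / u·u) u` and `u·u = 2 u·w`
    have hexp : ∀ j, ((if i = j then (1 : ℝ) else 0) - 2 / c * (u i * u j)) * w j =
        (if i = j then 1 else 0) * w j - 2 / c * u i * (u j * w j) := by intro j; ring
    simp only [hexp, Finset.sum_sub_distrib, ← Finset.mul_sum]
    have h1 : ∑ j, (if i = j then (1 : ℝ) else 0) * w j = w i := by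
      rw [Finset.sum_eq_single i]
      · simp
      · intro k _ hk; simp [Ne.symm hk]
      · intro h; exact absurd (Finset.mem_univ _) h
    have hnorm : ∑ j, w j ^ 2 = enorm w ^ 2 := (enorm_sq w).symm
    have huw : ∑ j, u j * w j = enorm w ^ 2 - enorm w * w i₀ := by
      have : ∀ j, u j * w j = w j ^ 2 - (if j = i₀ then enorm w else 0) * w j := fun j => by rw [hw j]; ring
      simp only [this, Finset.sum_sub_distrib, hnorm]
      congr 1
      rw [Finset.sum_eq_single i₀]
      · simp
      · intro k _ hk; simp [hk]
      · intro h; exact absurd (Finset.mem_univ _) h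
    have huu : c = 2 * (enorm w ^ 2 - enorm w * w i₀) := by
      rw [hc]
      have : ∀ j, u j ^ 2 = w j ^ 2 - 2 * ((if j = i₀ then enorm w else 0) * w j) + (if j = i₀ then enorm w else 0) ^ 2 := by
        intro j; rw [hw j]; ring
      simp only [this, Finset.sum_add_distrib, Finset.sum_sub_distrib, ← Finset.mul_sum, hnorm]
      have e1 : ∑ j, (if j = i₀ then enorm w else 0) * w j = enorm w * w i₀ := by
        rw [Finset.sum_eq_single i₀]
        · simp
        · intro k _ hk; simp [hk]
        · intro h; exact absurd (Finset.mem_univ _) h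
      have e2 : ∑ j, (if j = i₀ then enorm w else 0) ^ 2 = enorm w ^ 2 := by
        rw [Finset.sum_eq_single i₀]
        · simp
        · intro k _ hk; simp [hk]
        · intro h; exact absurd (Finset.mem_univ _) h
      rw [e1, e2]; ring
    rw [h1, huw]
    have hne : enorm w ^ 2 - enorm w * w i₀ ≠ 0 := by
      intro h; apply h0; rw [huu, h, mul_zero]
    rw [huu]
    have hkey : 2 / (2 * (enorm w ^ 2 - enorm w * w i₀)) * u i * (enorm w ^ 2 - enorm w * w i₀) = u i := by
      rw [div_mul_eq_mul_div, div_mul_eq_mul_div, mul_assoc 2 (u i), mul_comm (2 : ℝ) (enorm w ^ 2 - enorm w * w i₀),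
        show 2 * (u i * (enorm w ^ 2 - enorm w * w i₀)) = (u i) * ((enorm w ^ 2 - enorm w * w i₀) * 2) by ring,
        mul_div_assoc, div_self (mul_ne_zero hne two_ne_zero), mul_one]
    rw [hkey, hw i]
    simp only [hu]
    ring

/-! ### Slade's range of `Loc_x`: `𝒰 = span{1, τ_x, τ_x²}` -/

/-- **Slade's range of `Loc_x` ("the localisation operator is a linear projection `Loc_X : 𝒩 → 𝒰(X)`",
"symmetry considerations preclude the occurrence of monomials with an odd number of fields or an odd
number of gradients").** For `F ∈ 𝒩(U)` (`U` in the patch of `x`) invariant under the reflections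
of the axes through `x` and under the pointwise action of every orthogonal matrix on the components
(`O(n)`), and field/maximal dimensions with `d_+ < 2[φ] + 2`, `d_+ < 5[φ]` (Slade: `[φ] = ½(d-α)`,
`d_+ = d`, `α` near `d/2`), the localisation `Loc_x F = Loc_{{x}}F` is a local polynomial
`gτ_x² + ντ_x + u` with `τ_x = ½|φ_x|²`. Proof: the discrete symmetries kill every class with a
component occurring an odd number of times or an axis carrying an odd number of derivatives; the
survivors have no derivatives and even degree `≤ 4`, so `Loc_x F(φ) = P(φ_x)` for a polynomial `P`
on `ℝⁿ` invariant under `O(n)`; a Householder reflection makes it radial. [cite: Slade2017, §4.2 ("the localisation operator is a linear projection map Loc_X : 𝒩 → 𝒰(X)", range spanned by {1,τ,τ²}) and Definition 3.4.2 (the sentence following it)] -/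
theorem locX_singleton_eq_localPoly {pN : ℕ} {dφ dplus : ℝ} (hA : LocAdm M n pN dφ dplus) [NeZero n] (x : TorusSite d M)
    {U : Finset (TorusSite d M)} (hU : ∀ y ∈ U, ∀ k, 2 * |coord x y k| < M) (hK : 2 * ((⌊dplus⌋₊ : ℤ) + 1) < M)
    (hxU : reach x ⌊dplus⌋₊ ⊆ U) (h2 : dplus < 2 * dφ + 2) (h5 : dplus < 5 * dφ)
    {F : (TorusSite d M → Fin n → ℝ) → ℝ} (hF : ContDiff ℝ ∞ F) (hFU : DependsOn U F)
    (hrefl : ∀ k : Fin d, (fun φ => F ((reflAxis k).fieldMap x φ)) = F)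
    (hO : ∀ R : Fin n → Fin n → ℝ, IsOrth R → (fun φ => F (compMap R φ)) = F) :
    ∃ g' ν' u' : ℝ, locX pN dφ dplus x {x} F = localPoly g' ν' u' x := by
  have hXne : ({x} : Finset (TorusSite d M)).Nonempty := ⟨x, Finset.mem_singleton_self x⟩
  have hX : InPatch x ⌊dplus⌋₊ ({x} : Finset (TorusSite d M)) := by
    intro y hy j
    rw [Finset.mem_singleton.1 hy]
    simp only [coord, sub_self, ZMod.valMinAbs_zero, abs_zero, zero_add]
    omega
  have hEX : ∀ k : Fin d, ({x} : Finset (TorusSite d M)).image ((reflAxis k).pt x) = {x} := fun k => by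
    rw [Finset.image_singleton, AxisSym.pt_self]
  have hxU' : ∀ y ∈ ({x} : Finset (TorusSite d M)), reach y ⌊dplus⌋₊ ⊆ U := fun y hy => by
    rw [Finset.mem_singleton.1 hy]; exact hxU
  set β := betaVec pN dφ dplus x {x} F with hβ
  -- the killings
  have kill1 : ∀ (C : vPlus d n dφ dplus) (i : Fin n), Odd (((rep C.1).map Prod.fst).count i) → β C = 0 :=
    fun C i hodd => betaVec_eq_zero_of_flipComp hA i hXne hX hF (hO _ (isOrth_diagR_flipComp i)) C hodd
  have kill2 : ∀ (C : vPlus d n dφ dplus) (k : Fin d), Odd (((rep C.1).map fun c => c.2.count k).sum) → β C = 0 := by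
    intro C k hodd
    refine betaVec_eq_zero_of_reflAxis hA k hXne hX (hEX k) hU hK hxU' hF hFU (hrefl k) C ?_
    rw [sgnM_flipM_singleton, hodd.neg_one_pow]
  -- the survivors: no derivatives, even degree `≤ 4`
  have surv : ∀ C : vPlus d n dφ dplus, β C ≠ 0 →
      tordF (rep C.1) = 0 ∧ Even (rep C.1).length ∧ (rep C.1).length ≤ 4 := by
    intro C hC
    have hcnt : ∀ i, Even (((rep C.1).map Prod.fst).count i) := fun i => by
      by_contra h; exact hC (kill1 C i (Nat.not_even_iff_odd.1 h))
    have hax : ∀ k, Even (((rep C.1).map fun c => c.2.count k).sum) := fun k => by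
      by_contra h; exact hC (kill2 C k (Nat.not_even_iff_odd.1 h))
    have hlen : Even (rep C.1).length := by
      rw [length_eq_sum_count_fst]; exact Finset.even_sum _ fun i _ => hcnt i
    have htord : Even (tordF (rep C.1)) := even_tordF_of_all_even _ hax
    have hle := tordF_rep_le hA.pos C.2
    have hpos := hA.pos
    have hlen4 : (rep C.1).length ≤ 4 := by
      by_contra h
      have h5' : (5 : ℝ) ≤ (rep C.1).length := by exact_mod_cast (by omega : 5 ≤ (rep C.1).length)
      have : (5 : ℝ) * dφ ≤ (rep C.1).length * dφ := by nlinarith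
      have ht : (0 : ℝ) ≤ tordF (rep C.1) := Nat.cast_nonneg _
      linarith
    refine ⟨?_, hlen, hlen4⟩
    by_contra ht0
    obtain ⟨m₂, hm₂⟩ := htord
    have ht2 : 2 ≤ tordF (rep C.1) := by omega
    have hl : (rep C.1).length ≠ 0 := by
      intro h0
      have : rep C.1 = [] := List.length_eq_zero_iff.1 h0
      apply ht0; unfold tordF; rw [this]; rfl
    obtain ⟨l₂, hl₂⟩ := hlen
    have hl2 : 2 ≤ (rep C.1).length := by omega
    have h1 : (2 : ℝ) ≤ (rep C.1).length := by exact_mod_cast hl2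
    have h3 : (2 : ℝ) ≤ tordF (rep C.1) := by exact_mod_cast ht2
    nlinarith
  -- evaluation: `Loc_x F (φ) = P(φ_x)`
  set P : (Fin n → ℝ) → ℝ := fun w => ∑ C : vPlus d n dφ dplus, β C * ((rep C.1).map fun c => w c.1).prod with hP
  have hVP : ∀ φ, locX pN dφ dplus x {x} F φ = P (φ x) := by
    intro φ
    show ∑ C : vPlus d n dφ dplus, β C * phatX (rep C.1) {x} φ = _
    rw [hP]
    refine Finset.sum_congr rfl fun C _ => ?_
    by_cases hC : β C = 0
    · rw [hC, zero_mul, zero_mul]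
    · rw [phatX_singleton_of_tordF_eq_zero (surv C hC).1 x]
  -- `O(n)` invariance and radiality of `P`
  have hPinv : ∀ R, IsOrth R → ∀ w : Fin n → ℝ, P (fun i => ∑ j, R i j * w j) = P w := by
    intro R hR w
    have h := congrFun (locX_comp_compMap_of_invariant hA R hXne hX hF (hO R hR)) (siteField x w)
    rw [compMap_siteField, hVP, hVP, siteField_self, siteField_self] at h
    exact h
  have hhom : ∀ (t : ℝ) (w : Fin n → ℝ), P (fun i => t * w i) =
      ∑ C : vPlus d n dφ dplus, β C * (t ^ (rep C.1).length * ((rep C.1).map fun c => w c.1).prod) := by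
    intro t w
    rw [hP]
    exact Finset.sum_congr rfl fun C _ => by rw [prod_map_smul]
  set δ₀ : Fin n → ℝ := fun i => if i = 0 then 1 else 0 with hδ₀
  have hrad : ∀ w : Fin n → ℝ, P w = P (fun i => enorm w * δ₀ i) := by
    intro w
    rw [← hPinv (householder 0 w) (isOrth_householder 0 w) w]
    have hfun : (fun i => ∑ j, householder 0 w i j * w j) = fun i => enorm w * δ₀ i := by
      funext i
      rw [householder_apply, hδ₀]
      by_cases h : i = 0 <;> simp [h]
    rw [hfun]
  -- grouping by degree
  set A : ℕ → ℝ := fun k => ∑ C : vPlus d n dφ dplus,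
    (if (rep C.1).length = k then β C * ((rep C.1).map fun c => δ₀ c.1).prod else 0) with hAk
  have hgroup : ∀ E : ℝ, ∑ C : vPlus d n dφ dplus, β C * (E ^ (rep C.1).length * ((rep C.1).map fun c => δ₀ c.1).prod) =
      A 0 + A 2 * E ^ 2 + A 4 * E ^ 4 := by
    intro E
    rw [hAk]
    simp only [Finset.sum_mul, ← Finset.sum_add_distrib]
    refine Finset.sum_congr rfl fun C _ => ?_
    by_cases hC : β C = 0
    · simp [hC]
    · obtain ⟨_, ⟨l₂, hl₂⟩, hle⟩ := surv C hC
      have hcases : (rep C.1).length = 0 ∨ (rep C.1).length = 2 ∨ (rep C.1).length = 4 := by omega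
      rcases hcases with h | h | h <;> simp [h] <;> ring
  refine ⟨4 * A 4, 2 * A 2, A 0, ?_⟩
  funext φ
  rw [hVP, hrad, hhom, hgroup]
  have hE2 : enorm (φ x) ^ 2 = 2 * tau x φ := by
    rw [enorm_sq]; simp only [tau]; ring
  have hE4 : enorm (φ x) ^ 4 = (2 * tau x φ) ^ 2 := by rw [← hE2]; ring
  rw [hE4, hE2]
  simp only [localPoly]
  ring

end Loc

end LongRangePhi4

end Literature.Barriers.CriticalPhenomena

end
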